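import Summits.QuantumFields.BalabanUV.Beta.D1BFx.GhostWordEnvelope

/-!
# `BalabanUV.Beta.D1BFx.GhostWordFamilies` — road «BF-x» for binder row D1, slot (K), DICT-CHAIN-SPEC §2 (II) row RK-GH, «RK-GH-UNIT» FILE 1b:
# **THE MIRROR BUBBLE ENVELOPE (DECAY ON THE SECOND LEG) AND THE TADPOLE ∕ TWO-LEG BUBBLE WORD FAMILIES AS (5.10)-KERNELS WITH LETTER-PRODUCT CONSTANTS**
# — companion of `GhostWordEnvelope` (FILE 1a), split off by the 400-line rule; generic dimension `D`, fibre `F`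

HONEST DEPENDENCY (cell records, verbatim): «continuum YM on T⁴ ⇐ BetaPertH ∧ nine spine estimates (0/9 proved); BetaPertH ⇐ (D1) ∧ (D4) ∧
CAP+tail; G-an2-4 gates asym, D1 and NE2/3/4.»  HONEST FRAMING (cell contract, verbatim): «discharging `BetaPertH` makes Bałaban's UV stability
UNCONDITIONAL — a real constructive-QFT result; it is NOT the continuum limit and NOT the Clay problem.»  THIS MODULE DISCHARGES NOTHING of the
wall: [folklore] `ℓ¹` bookkeeping over FILE 1a (`abs_comp_le_of_decays` ∕ `abs_comp_le_of_bdd` ∕ `abs_tr_comp_le_of_separable` ∕ `abs_tadpole_le_of_bdd_mass` ∕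
`abs_biBubble_le_of_decays_bdd_mass`), an2's `ExpKernelCalculus` and `B12Sec2to5.Decay510`.  Every letter is a DISPLAYED hypothesis on ARBITRARY kernels;
nothing about Bałaban's operators is asserted.  No `def`, no `def … : Prop`, nothing cited, 0 sorry.  NO unit row is proved HERE (FILE 4
`RestKernelGhostUnit`); 0 root-level binders of row D1 discharged (hW ∕ hR-sockets ∕ hSX-socket ∕ D1Tel ∕ D1Rep — 0); (K) NOT closed; NOT D1, NOT
`BetaPertH`, NOT continuum, NOT Clay.

ABSOLUTE RULE (cell charter, verbatim): «No internally-minted statement may enter as a cited fact. Every hypothesis is either kernel-proved in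
this package or a verbatim quotation of a PUBLISHED theorem with page reference. The manuscript(s) under audit are NOT citable for their own
disputed steps — they are the thing under adjudication; programme-internal (2001/route/tribunal) claims are never citable.»

WHY (journal INTENT 1 «RK-GH-UNIT» [D1LEAF04-G18-ONLINE]; `RestKernelGhostWords.GhIdx`): of the twelve ghost rest words, the single-`P` pairs
`(G∘G, P)` and the double-`P` pairs `(G∘P∘G, P)` ∕ `(P, G∘P∘G)` want the DECAYING letter on the `P`-type SECOND leg (its sharp sup `cPPs·n⁻⁴` must sit on
the `Decays` side while the `O(1)` composite sits on the `Bdd` side) — the mirror of FILE 1a's bubble envelope; and every word is consumed as a FAMILY in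
the coarse separation `z` (first jets `𝒱 μ 0`, `𝒱′ ν z` centred at `N•0`, `N•z`; tables `𝒲 μ 0 ν z`), i.e. as a `Decay510` kernel whose constant is a PRODUCT OF
LETTERS — then `B12Sec2to5.secondMoment_abs_le_of_decay510` gives the (1.22) moment BY NAME with `betaPrime510 D (S₁·S₂·m·m′) (σ·N)`.

CONTENT (all [folklore]):
* §1 **`abs_biBubble_le_of_bdd_decays_mass`** (`Bdd L₁ S₁`, `Decays L₂ S₂ σ`; jets by centred weighted masses at `c`, `c′`):
  `|biBubble L₁ V L₂ V′| ≤ S₁·S₂·M_V(c)·M_{V′}(c′)·e^{−σ|c′ − c|₁}` — the bounded first leg borrows the weight at the column index, the decaying second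
  leg transports it to the column of `V′`.
* §2 `exp_centres` (`e^{−σ|N•z − N•0|₁} = e^{−(σN)|z|₁}`); **`decay510_tadpoleWord_of_mass`** (`Bdd L S`, `Σ mass (𝒲 μ 0 ν z) ≤ mW·e^{−κ|z|₁}` ⊢
  `Decay510 (z ↦ tadpole L (𝒲 μ 0 ν z)) (S·mW) κ`); **`decay510_biBubbleWord_of_decays_bdd_mass`** ∕ **`decay510_biBubbleWord_of_bdd_decays_mass`**
  (masses of `𝒱 μ y` at `N•y` `≤ m`, of `𝒱′ ν y′` `≤ m′` ⊢ `Decay510 (z ↦ biBubble L₁ (𝒱 μ 0) L₂ (𝒱′ ν z)) (S₁·S₂·m·m′) (σ·N)`).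
NOT HERE (honest): the road's leg letters (FILE 2), the packed ghost jets' masses (FILE 3), the twelve rows (FILE 4); any statement about `Ggh`, `Pgt`, `wH`.
Unit `b2b-balaban-beta-d1-formalise-leaf-04` (gen 18), D1 formalisation swarm leaf prover 04, road «BF-x»; INTENT 1 «RK-GH-UNIT» FILE 1b (journal).
-/

noncomputable section

open Finset
open scoped BigOperators
open Literature.MathematicalPhysics.QuantumFieldTheory.Balaban1983to89
open Literature.MathematicalPhysics.QuantumFieldTheory.Balaban1983to89.Beta
open B12Sec2to5 (l1 l1_nonneg Decay510)
open ExpKernelCalculus (Site MKer Decays comp tr tadpole l1_sub_triangle l1_sub_symm l1_natSmul)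
open KernelWard (Bdd)
open Summit.QuantumFields.BalabanUV.Beta.D1BFx.PackedKernelSplit (biBubble)
open Summit.QuantumFields.BalabanUV.Beta.D1BFx.GhostWordEnvelope

namespace Summit.QuantumFields.BalabanUV.Beta.D1BFx.GhostWordFamilies

variable {D : ℕ} {F : Type*} [Fintype F]

/-! ## §1 The mirror bubble envelope: decay on the second leg -/

section Bubble

variable {L₁ L₂ V V' : MKer D F} {S₁ S₂ σ : ℝ}

/-- [folklore] **THE TWO-LEG BUBBLE WORD, DECAY ON THE SECOND LEG**: `Bdd L₁ S₁`, `Decays L₂ S₂ σ` (`0 ≤ σ, S₁, S₂`), jets `V`, `V′` with summable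
centred weighted masses at `c`, `c′` ⊢ the same envelope
`|biBubble L₁ V L₂ V′| ≤ S₁·S₂·(Σ' weighted mass of V at c)·(Σ' weighted mass of V′ at c′)·e^{−σ|c′ − c|₁}`. -/
theorem abs_biBubble_le_of_bdd_decays_mass (c c' : Site D)
    (hL₁ : Bdd L₁ S₁) (hL₂ : Decays L₂ S₂ σ) (hσ : 0 ≤ σ) (hS₁ : 0 ≤ S₁) (hS₂ : 0 ≤ S₂)
    (hV : Summable fun p : Site D × Site D => ∑ g, ∑ f, |V p.1 p.2 g f| * Real.exp (σ * (l1 (p.1 - c) + l1 (p.2 - c))))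
    (hV' : Summable fun p : Site D × Site D => ∑ g, ∑ f, |V' p.1 p.2 g f| * Real.exp (σ * (l1 (p.1 - c') + l1 (p.2 - c')))) :
    |biBubble L₁ V L₂ V'| ≤ S₁ * S₂
      * (∑' p : Site D × Site D, ∑ g, ∑ f, |V p.1 p.2 g f| * Real.exp (σ * (l1 (p.1 - c) + l1 (p.2 - c))))
      * (∑' p : Site D × Site D, ∑ g, ∑ f, |V' p.1 p.2 g f| * Real.exp (σ * (l1 (p.1 - c') + l1 (p.2 - c'))))
      * Real.exp (-σ * l1 (c' - c)) := by
  -- the two separable majorants: the bounded first leg borrows the weight at `z`, the decaying second leg transports it to `x`'s column of `V′`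
  have hA : ∀ x z a f, |comp L₁ V x z a f| ≤ (1 : ℝ) * ((S₁ * Real.exp (-σ * l1 (z - c)))
      * ∑' y : Site D, ∑ g, |V y z g f| * Real.exp (σ * (l1 (y - c) + l1 (z - c)))) := fun x z a f => by
    rw [one_mul]; exact abs_comp_le_of_bdd c hL₁ hσ hS₁ x z a f (summable_section_fibre c hV z f)
  have hB : ∀ z x f a, |comp L₂ V' z x f a| ≤ (S₂ * Real.exp (-σ * l1 (z - c')))
      * ∑' w : Site D, ∑ h, |V' w x h a| * Real.exp (σ * (l1 (w - c') + l1 (x - c'))) := fun z x f a =>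
    abs_comp_le_of_decays c' hL₂ hσ hS₂ z x f a (summable_section_fibre c' hV' x a)
  have hcolV := summable_tsum_snd (Φ := fun y z => ∑ g, ∑ f, |V y z g f| * Real.exp (σ * (l1 (y - c) + l1 (z - c)))) hV
  have hcolV' := summable_tsum_snd (Φ := fun w x => ∑ h, ∑ a, |V' w x h a| * Real.exp (σ * (l1 (w - c') + l1 (x - c')))) hV'
  have hxs : Summable fun x : Site D => (1 : ℝ) * ∑ a, ∑' w : Site D, ∑ h, |V' w x h a| * Real.exp (σ * (l1 (w - c') + l1 (x - c'))) := by
    refine hcolV'.congr fun x => ?_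
    rw [one_mul, sum_profile_eq c' hV' x]
  have hpt : ∀ z, (S₂ * Real.exp (-σ * l1 (z - c'))) * ∑ f, (S₁ * Real.exp (-σ * l1 (z - c)))
        * ∑' y : Site D, ∑ g, |V y z g f| * Real.exp (σ * (l1 (y - c) + l1 (z - c)))
      ≤ S₁ * S₂ * Real.exp (-σ * l1 (c' - c))
        * ∑' y : Site D, ∑ g, ∑ f, |V y z g f| * Real.exp (σ * (l1 (y - c) + l1 (z - c))) := by
    intro z
    rw [← Finset.mul_sum, sum_profile_eq c hV z]
    have hw := exp_weight_pair hσ z c c'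
    have hm : 0 ≤ ∑' y : Site D, ∑ g, ∑ f, |V y z g f| * Real.exp (σ * (l1 (y - c) + l1 (z - c))) :=
      tsum_nonneg fun y => Finset.sum_nonneg fun g _ => Finset.sum_nonneg fun f _ => by positivity
    calc S₂ * Real.exp (-σ * l1 (z - c')) * (S₁ * Real.exp (-σ * l1 (z - c)) * _)
        = (S₁ * S₂) * (Real.exp (-σ * l1 (z - c)) * Real.exp (-σ * l1 (z - c'))) * _ := by ring
      _ ≤ (S₁ * S₂) * Real.exp (-σ * l1 (c' - c)) * _ :=
          mul_le_mul_of_nonneg_right (mul_le_mul_of_nonneg_left hw (mul_nonneg hS₁ hS₂)) hm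
  have hzs : Summable fun z : Site D => (S₂ * Real.exp (-σ * l1 (z - c'))) * ∑ f, (S₁ * Real.exp (-σ * l1 (z - c)))
      * ∑' y : Site D, ∑ g, |V y z g f| * Real.exp (σ * (l1 (y - c) + l1 (z - c))) :=
    Summable.of_nonneg_of_le
      (fun z => mul_nonneg (by positivity) (Finset.sum_nonneg fun f _ => mul_nonneg (by positivity)
        (tsum_nonneg fun y => Finset.sum_nonneg fun g _ => by positivity)))
      hpt (hcolV.mul_left (S₁ * S₂ * Real.exp (-σ * l1 (c' - c))))
  have h := abs_tr_comp_le_of_separable (A := comp L₁ V) (B := comp L₂ V')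
    (α := fun _ => (1 : ℝ))
    (ρ := fun z f => (S₁ * Real.exp (-σ * l1 (z - c))) * ∑' y : Site D, ∑ g, |V y z g f| * Real.exp (σ * (l1 (y - c) + l1 (z - c))))
    (β := fun z => S₂ * Real.exp (-σ * l1 (z - c')))
    (κ := fun x a => ∑' w : Site D, ∑ h, |V' w x h a| * Real.exp (σ * (l1 (w - c') + l1 (x - c'))))
    hA hB (fun x => zero_le_one) (fun z f => mul_nonneg (by positivity) (tsum_nonneg fun y => Finset.sum_nonneg fun g _ => by positivity))
    hxs hzs
  unfold PackedKernelSplit.biBubble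
  refine h.trans ?_
  have hx : ∑' x : Site D, (1 : ℝ) * ∑ a, ∑' w : Site D, ∑ h, |V' w x h a| * Real.exp (σ * (l1 (w - c') + l1 (x - c')))
      = ∑' p : Site D × Site D, ∑ g, ∑ f, |V' p.1 p.2 g f| * Real.exp (σ * (l1 (p.1 - c') + l1 (p.2 - c'))) := by
    rw [← tsum_tsum_snd_eq (Φ := fun w x => ∑ h, ∑ a, |V' w x h a| * Real.exp (σ * (l1 (w - c') + l1 (x - c')))) hV']
    exact tsum_congr fun x => by rw [one_mul, sum_profile_eq c' hV' x]
  have hz : ∑' z : Site D, (S₂ * Real.exp (-σ * l1 (z - c'))) * ∑ f, (S₁ * Real.exp (-σ * l1 (z - c)))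
        * ∑' y : Site D, ∑ g, |V y z g f| * Real.exp (σ * (l1 (y - c) + l1 (z - c)))
      ≤ S₁ * S₂ * Real.exp (-σ * l1 (c' - c))
        * ∑' p : Site D × Site D, ∑ g, ∑ f, |V p.1 p.2 g f| * Real.exp (σ * (l1 (p.1 - c) + l1 (p.2 - c))) := by
    rw [← tsum_tsum_snd_eq (Φ := fun y z => ∑ g, ∑ f, |V y z g f| * Real.exp (σ * (l1 (y - c) + l1 (z - c)))) hV,
      ← tsum_mul_left]
    exact Summable.tsum_le_tsum hpt hzs (hcolV.mul_left _)
  rw [hx]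
  have hMV' : 0 ≤ ∑' p : Site D × Site D, ∑ g, ∑ f, |V' p.1 p.2 g f| * Real.exp (σ * (l1 (p.1 - c') + l1 (p.2 - c'))) :=
    tsum_nonneg fun p => Finset.sum_nonneg fun g _ => Finset.sum_nonneg fun f _ => by positivity
  refine (mul_le_mul_of_nonneg_left hz hMV').trans (le_of_eq ?_)
  ring

end Bubble

/-! ## §2 The word families as (5.10)-kernels -/

section Families

variable {L L₁ L₂ : MKer D F} {𝒱 𝒱' : Fin D → Site D → MKer D F} {𝒲 : Fin D → Site D → Fin D → Site D → MKer D F}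
  {S S₁ S₂ σ m m' mW κ : ℝ} {N : ℕ}

/-- [folklore] **THE TADPOLE FAMILY IS A (5.10)-KERNEL**: `Bdd L S` (`0 ≤ S`) and the mass letter
`Σ'_{(y,x)} Σ_{g a} |𝒲 μ 0 ν z y x g a| ≤ mW·e^{−κ|z|₁}` (all `z`) give `Decay510 (z ↦ tadpole L (𝒲 μ 0 ν z)) (S·mW) κ`. -/
theorem decay510_tadpoleWord_of_mass (hL : Bdd L S) (hS : 0 ≤ S) (μ ν : Fin D)
    (h𝒲s : ∀ z, Summable fun p : Site D × Site D => ∑ g, ∑ a, |𝒲 μ 0 ν z p.1 p.2 g a|)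
    (h𝒲m : ∀ z, ∑' p : Site D × Site D, ∑ g, ∑ a, |𝒲 μ 0 ν z p.1 p.2 g a| ≤ mW * Real.exp (-κ * l1 z)) :
    Decay510 (fun z => tadpole L (𝒲 μ 0 ν z)) (S * mW) κ := by
  intro z
  refine (abs_tadpole_le_of_bdd_mass hL (h𝒲s z)).trans ?_
  calc S * _ ≤ S * (mW * Real.exp (-κ * l1 z)) := mul_le_mul_of_nonneg_left (h𝒲m z) hS
    _ = S * mW * Real.exp (-κ * l1 z) := by ring

/-- [folklore] The coarse exponential at the two centres `N•0`, `N•z`: `e^{−σ|N•z − N•0|₁} = e^{−(σ·N)|z|₁}`. -/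
theorem exp_centres (σ : ℝ) (N : ℕ) (z : Site D) :
    Real.exp (-σ * l1 ((N : ℤ) • z - (N : ℤ) • (0 : Site D))) = Real.exp (-(σ * N) * l1 z) := by
  rw [smul_zero, sub_zero, l1_natSmul]; ring_nf

/-- [folklore] **THE TWO-LEG BUBBLE FAMILY IS A (5.10)-KERNEL, DECAY ON THE FIRST LEG**: `Decays L₁ S₁ σ`, `Bdd L₂ S₂` (`0 ≤ σ, S₁, S₂`), first jets
`𝒱 μ y` with centred weighted masses `≤ m` (centre `N•y`, rate `σ`) and `𝒱′ ν y′` with masses `≤ m′` give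
`Decay510 (z ↦ biBubble L₁ (𝒱 μ 0) L₂ (𝒱′ ν z)) (S₁·S₂·m·m′) (σ·N)`. -/
theorem decay510_biBubbleWord_of_decays_bdd_mass (hL₁ : Decays L₁ S₁ σ) (hL₂ : Bdd L₂ S₂) (hσ : 0 ≤ σ) (hS₁ : 0 ≤ S₁) (hS₂ : 0 ≤ S₂)
    (μ ν : Fin D)
    (h𝒱s : ∀ y, Summable fun p : Site D × Site D =>
      ∑ g, ∑ f, |𝒱 μ y p.1 p.2 g f| * Real.exp (σ * (l1 (p.1 - (N : ℤ) • y) + l1 (p.2 - (N : ℤ) • y))))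
    (h𝒱m : ∀ y, ∑' p : Site D × Site D,
      ∑ g, ∑ f, |𝒱 μ y p.1 p.2 g f| * Real.exp (σ * (l1 (p.1 - (N : ℤ) • y) + l1 (p.2 - (N : ℤ) • y))) ≤ m)
    (h𝒱's : ∀ y, Summable fun p : Site D × Site D =>
      ∑ g, ∑ f, |𝒱' ν y p.1 p.2 g f| * Real.exp (σ * (l1 (p.1 - (N : ℤ) • y) + l1 (p.2 - (N : ℤ) • y))))
    (h𝒱'm : ∀ y, ∑' p : Site D × Site D,
      ∑ g, ∑ f, |𝒱' ν y p.1 p.2 g f| * Real.exp (σ * (l1 (p.1 - (N : ℤ) • y) + l1 (p.2 - (N : ℤ) • y))) ≤ m') :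
    Decay510 (fun z => biBubble L₁ (𝒱 μ 0) L₂ (𝒱' ν z)) (S₁ * S₂ * m * m') (σ * N) := by
  intro z
  have h := abs_biBubble_le_of_decays_bdd_mass ((N : ℤ) • (0 : Site D)) ((N : ℤ) • z) hL₁ hL₂ hσ hS₁ hS₂ (h𝒱s 0) (h𝒱's z)
  rw [exp_centres] at h
  refine h.trans ?_
  have hm : 0 ≤ m := (tsum_nonneg fun p => Finset.sum_nonneg fun g _ => Finset.sum_nonneg fun f _ => by positivity).trans (h𝒱m 0)
  have hM' : 0 ≤ ∑' p : Site D × Site D,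
      ∑ g, ∑ f, |𝒱' ν z p.1 p.2 g f| * Real.exp (σ * (l1 (p.1 - (N : ℤ) • z) + l1 (p.2 - (N : ℤ) • z))) :=
    tsum_nonneg fun p => Finset.sum_nonneg fun g _ => Finset.sum_nonneg fun f _ => by positivity
  have hE := (Real.exp_pos (-(σ * N) * l1 z)).le
  have h1 := mul_le_mul_of_nonneg_left (h𝒱m 0) (mul_nonneg hS₁ hS₂)
  have h2 := mul_le_mul h1 (h𝒱'm z) hM' (mul_nonneg (mul_nonneg hS₁ hS₂) hm)
  exact mul_le_mul_of_nonneg_right h2 hE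

/-- [folklore] **THE TWO-LEG BUBBLE FAMILY IS A (5.10)-KERNEL, DECAY ON THE SECOND LEG** (`Bdd L₁ S₁`, `Decays L₂ S₂ σ`; same letters, same envelope). -/
theorem decay510_biBubbleWord_of_bdd_decays_mass (hL₁ : Bdd L₁ S₁) (hL₂ : Decays L₂ S₂ σ) (hσ : 0 ≤ σ) (hS₁ : 0 ≤ S₁) (hS₂ : 0 ≤ S₂)
    (μ ν : Fin D)
    (h𝒱s : ∀ y, Summable fun p : Site D × Site D =>
      ∑ g, ∑ f, |𝒱 μ y p.1 p.2 g f| * Real.exp (σ * (l1 (p.1 - (N : ℤ) • y) + l1 (p.2 - (N : ℤ) • y))))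
    (h𝒱m : ∀ y, ∑' p : Site D × Site D,
      ∑ g, ∑ f, |𝒱 μ y p.1 p.2 g f| * Real.exp (σ * (l1 (p.1 - (N : ℤ) • y) + l1 (p.2 - (N : ℤ) • y))) ≤ m)
    (h𝒱's : ∀ y, Summable fun p : Site D × Site D =>
      ∑ g, ∑ f, |𝒱' ν y p.1 p.2 g f| * Real.exp (σ * (l1 (p.1 - (N : ℤ) • y) + l1 (p.2 - (N : ℤ) • y))))
    (h𝒱'm : ∀ y, ∑' p : Site D × Site D,
      ∑ g, ∑ f, |𝒱' ν y p.1 p.2 g f| * Real.exp (σ * (l1 (p.1 - (N : ℤ) • y) + l1 (p.2 - (N : ℤ) • y))) ≤ m') :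
    Decay510 (fun z => biBubble L₁ (𝒱 μ 0) L₂ (𝒱' ν z)) (S₁ * S₂ * m * m') (σ * N) := by
  intro z
  have h := abs_biBubble_le_of_bdd_decays_mass ((N : ℤ) • (0 : Site D)) ((N : ℤ) • z) hL₁ hL₂ hσ hS₁ hS₂ (h𝒱s 0) (h𝒱's z)
  rw [exp_centres] at h
  refine h.trans ?_
  have hm : 0 ≤ m := (tsum_nonneg fun p => Finset.sum_nonneg fun g _ => Finset.sum_nonneg fun f _ => by positivity).trans (h𝒱m 0)
  have hM' : 0 ≤ ∑' p : Site D × Site D,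
      ∑ g, ∑ f, |𝒱' ν z p.1 p.2 g f| * Real.exp (σ * (l1 (p.1 - (N : ℤ) • z) + l1 (p.2 - (N : ℤ) • z))) :=
    tsum_nonneg fun p => Finset.sum_nonneg fun g _ => Finset.sum_nonneg fun f _ => by positivity
  have hE := (Real.exp_pos (-(σ * N) * l1 z)).le
  have h1 := mul_le_mul_of_nonneg_left (h𝒱m 0) (mul_nonneg hS₁ hS₂)
  have h2 := mul_le_mul h1 (h𝒱'm z) hM' (mul_nonneg (mul_nonneg hS₁ hS₂) hm)
  exact mul_le_mul_of_nonneg_right h2 hE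

end Families


end Summit.QuantumFields.BalabanUV.Beta.D1BFx.GhostWordFamilies

end
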